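import Mathlib
import Literature.AlgebraicGeometry.Resolution.ResolutionOfSingularities
import HarnessLib

/-!
# Birational morphisms pull back along affine spaces
(crux `FrobeniusLadder.FRationalResolution`, line `Sketch`)

Stub `stub_isBirational_affineSpace_map` of the skeleton `Sketch` for crux
stmt-ResolutionOfSingularities-15317 (theme: resolutions pull back along affine spaces,
`HasResolution X ⇒ HasResolution 𝔸ⁿ_X`). If `π : X' ⟶ X` is birational in the elementary sense of
`Literature.AlgebraicGeometry.Resolution.IsBirational` (an isomorphism over a dense open `U ⊆ X`
with dense preimage), then so is `𝔸ⁿ(π) : 𝔸ⁿ_{X'} ⟶ 𝔸ⁿ_X`, with the dense open `p⁻¹(U)` for the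
(open, `AffineSpace.isOpenMap_over`) projection `p : 𝔸ⁿ_X ⟶ X`:

* preimages of dense sets under open maps are dense (`Dense.preimage`), and
  `𝔸ⁿ(π)⁻¹(p⁻¹(U)) = p'⁻¹(π⁻¹(U))` by `AffineSpace.map_over`;
* `𝔸ⁿ_{X'}` is the fibre product `𝔸ⁿ_X ×_X X'` (`AffineSpace.isPullback_map`), so the restriction
  of `𝔸ⁿ(π)` over `p⁻¹(U)` is the base change of `π ∣_ U` along `p ∣_ U`
  (`Scheme.Hom.isPullback_resLE`), hence an isomorphism.
-/

set_option linter.dupNamespace false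

noncomputable section

open CategoryTheory CategoryTheory.Limits AlgebraicGeometry TopologicalSpace
  Literature.AlgebraicGeometry.Resolution

universe u

namespace Summit.ResolutionOfSingularities.ResolutionOfSingularities.Theorems.FRationalResolution

/-- In a cartesian square `g ≫ iX = iY ≫ f` of schemes, if `f` restricts to an isomorphism over an
open `U ⊆ S`, then `g` restricts to an isomorphism over `iX⁻¹(U)`: the restriction `g ∣_ iX⁻¹(U)` is
the base change of `f ∣_ U` along `iX ∣_ U` (Mathlib `Scheme.Hom.isPullback_resLE`). -/
theorem isIso_morphismRestrict_preimage_of_isPullback {X Y S T : Scheme.{u}} {f : T ⟶ S}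
    {g : Y ⟶ X} {iX : X ⟶ S} {iY : Y ⟶ T} (H : IsPullback g iY iX f) (U : S.Opens)
    (hU : IsIso (f ∣_ U)) : IsIso (g ∣_ iX ⁻¹ᵁ U) := by
  have hUY : g ⁻¹ᵁ iX ⁻¹ᵁ U = g ⁻¹ᵁ iX ⁻¹ᵁ U ⊓ iY ⁻¹ᵁ f ⁻¹ᵁ U := by
    have h : g ⁻¹ᵁ iX ⁻¹ᵁ U = iY ⁻¹ᵁ f ⁻¹ᵁ U := by
      rw [← Scheme.Hom.comp_preimage, H.w, Scheme.Hom.comp_preimage]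
    rw [← h, inf_idem]
  have key := Scheme.Hom.isPullback_resLE H (US := U) (UT := f ⁻¹ᵁ U) (UX := iX ⁻¹ᵁ U)
    le_rfl le_rfl hUY
  have hU' : IsIso (f.resLE U (f ⁻¹ᵁ U) le_rfl) := by
    rwa [Scheme.Hom.resLE_eq_morphismRestrict]
  have h := key.isIso_fst_of_isIso hU'
  rwa [Scheme.Hom.resLE_eq_morphismRestrict] at h

/-- BIRATIONAL MORPHISMS PULL BACK ALONG AFFINE SPACES. If `π : X' ⟶ X` is an isomorphism over a
dense open `U ⊆ X` with dense preimage, then `𝔸ⁿ(π) : 𝔸ⁿ_{X'} ⟶ 𝔸ⁿ_X` is an isomorphism over the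
dense open `p⁻¹(U)` (`p : 𝔸ⁿ_X ⟶ X` the open projection) with dense preimage `p'⁻¹(π⁻¹(U))`:
`𝔸ⁿ_{X'} = 𝔸ⁿ_X ×_X X'`, so the restriction over `p⁻¹(U)` is a base change of `π ∣_ U`.
[Stacks 01RN (birational morphisms); folklore] -/
theorem stub_isBirational_affineSpace_map (n : ℕ) (X' X : Scheme.{0}) (π : X' ⟶ X)
    (hπ : IsBirational π) : IsBirational (AffineSpace.map (Fin n) π) := by
  obtain ⟨U, hU, hU', hiso⟩ := hπ
  refine ⟨(𝔸(Fin n; X) ↘ X) ⁻¹ᵁ U, ?_, ?_, ?_⟩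
  · exact hU.preimage (AffineSpace.isOpenMap_over X)
  · rw [← Scheme.Hom.comp_preimage, AffineSpace.map_over, Scheme.Hom.comp_preimage]
    exact hU'.preimage (AffineSpace.isOpenMap_over X')
  · exact isIso_morphismRestrict_preimage_of_isPullback (AffineSpace.isPullback_map π) U hiso

end Summit.ResolutionOfSingularities.ResolutionOfSingularities.Theorems.FRationalResolution

end
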